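import Summits.QuantumFields.YangMills.Theorems.AllWindowsColdBoxBoxHighLineSmearedFPWeight
import Summits.QuantumFields.YangMills.Theorems.AllWindowsColdBoxBoxHighLineLandauBallQuaternion
import Summits.QuantumFields.YangMills.Theorems.AllWindowsColdBoxBoxHighLineLandauBallEdge
import Summits.QuantumFields.YangMills.Theorems.AllWindowsColdBoxBoxHighLineLandauBallSums

/-!
# TASK T-S5/U5 step (1), part 3 (T-S5.3): ORBIT LOCALISATION of the smeared gauge fixing (deterministic)

Planner ym-idea-2 g17's `Cruxes/BoxWindowHighSU2213/STUB-PLAN-S5U5-STEP1.md` (sha12 9448383ae86e), task T-S5.3 — shared step (1) of the XL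
comparison stubs S5 (LINE-19 ⟨stmt-QuantumFields-24004⟩/⟨24335⟩) and U5 (LINE-20 ⟨24336⟩).  Let `U` be a configuration and `g₀` an INTERIOR
gauge transformation putting `U` in the `r₀`-ball (`linkDefect (U^{g₀}) e ≤ r₀²` on every cold-box link; downstream `U^{g₀}` is the small
Landau representative of ✓S4b/U2, unique by ✓U3).  For any other interior `g` write `h = g·g₀⁻¹` (so `U^g = (U^{g₀})^h`,
`gaugeTransformZd_relGauge`) and `ψ = su2Quat ∘ h` (unit quaternions, `ψ = 1` off the interior sites).  Two inclusions:

* (⊂, **no far Gribov copy meets the support of the cutoff**) `norm_su2Quat_relGauge_sub_one_le`: if `U^g` lies in the `r₁`-ball then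
  `‖ψ x − 1‖ ≤ 2(r₀ + r₁)·H` for EVERY site `x` — per box edge `‖ψ(e₋) − ψ(e₊)‖ ≤ ‖q(U^{g₀}_e) − 1‖ + ‖q(U^g_e) − 1‖ ≤ r₀ + r₁`
  (✓`LandauBall.norm_sub_le_of_transform`), then walk down axis `0` to the frozen wall (✓`LandauBall.norm_sub_one_le_of_edges`).
  Cutoff form `norm_su2Quat_relGauge_sub_one_le_of_ballCutoff_ne_zero`: `ballCutoff H r (U^g) ≠ 0 ⇒ ‖ψ x − 1‖ ≤ 2(r₀ + 2|r|)·H`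
  (support lemma ✓`linkDefect_lt_of_ballCutoff_ne_zero` of T-S5.2), and the same for the weight `fpWeight β H r`.
* (⊃, **the cutoff is identically `1` near `g₀`**) `linkDefect_gaugeTransformZd_le_of_near_one`: if `‖ψ x − 1‖ ≤ δ` for all `x` then
  `(U^{g₀})^h` lies in the `(r₀ + 2δ)`-ball (`‖ψ_x q ψ_y⋆ − 1‖ ≤ ‖q − 1‖ + ‖ψ_x − ψ_y‖`), hence `ballCutoff H r (U^g) = 1` as soon as
  `r₀ + 2δ ≤ r` (`ballCutoff_gaugeTransformZd_eq_one_of_near_one`).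

Both are also stated for `InteriorGauge H`-valued transformations through `extendGauge` (`extendGauge_inv`, `extendGauge_relGauge`;
`orbitLocalisation_of_ballCutoff_ne_zero`, `ballCutoff_orbit_eq_one`) — the form in which T-S5.4 (Laplace asymptotics of the orbit average
`N_{h_β}(U) = ∫ h_β(U^{ext k}) dk`) consumes them: the integrand vanishes unless `k·k₀⁻¹` is `2(r₀+2r)H`-close to `1` at every interior site, and
the cutoff factor is `1` on the `(r − r₀)/2`-neighbourhood of `k₀`.

HONEST LABEL: a deterministic helper of ONE shared step of two XL stubs; S5, U5, ⟨24004⟩ ⟨24335⟩ ⟨24336⟩ remain OPEN; no crux, rung or summit is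
proved; the Yang–Mills mass gap is NOT proved by this file.
-/

set_option autoImplicit false

noncomputable section

open Finset Quaternion
open Literature.MathematicalPhysics.QuantumFieldTheory.AxialGauge (boxEdges mem_boxEdges_iff)
open Literature.MathematicalPhysics.QuantumLattice (su2Quat norm_su2Quat gaugeTransformZd LGConfig ZdEdge)
open Literature.Probability.LatticeModels (Site)
open Summit.QuantumFields.YangMills.Theorems.AllWindowsColdBoxBoxHighLine.LandauBall

namespace Summit.QuantumFields.YangMills.Theorems.AllWindowsColdBoxBoxHighLine

/-! ## The relative gauge transformation `h = g·g₀⁻¹` -/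

/-- `U^g = (U^{g₀})^{g·g₀⁻¹}`. -/
theorem gaugeTransformZd_relGauge (g g₀ : Site 4 → SU2) (U : LGConfig 4 SU2) :
    gaugeTransformZd (fun x => g x * (g₀ x)⁻¹) (gaugeTransformZd g₀ U) = gaugeTransformZd g U := by
  rw [gaugeTransformZd_gaugeTransformZd_eq]
  congr 1
  funext x
  simp

/-- The relative transformation of two interior gauge transformations is interior. -/
theorem isInteriorGauge_relGauge {H : ℕ} {g g₀ : Site 4 → SU2} (hg : IsInteriorGauge H g) (hg₀ : IsInteriorGauge H g₀) :
    IsInteriorGauge H fun x => g x * (g₀ x)⁻¹ := fun x hx => by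
  simp [hg x hx, hg₀ x hx]

/-! ## (⊂) No far Gribov copy meets the support of the cutoff -/

/-- **Orbit localisation, sup form.**  If the interior transformations `g₀`, `g` put `U` in the `r₀`-ball, resp. the `r₁`-ball, on every
cold-box link, then `h = g·g₀⁻¹` is `2(r₀ + r₁)H`-close to the identity at every site (in the quaternion norm). -/
theorem norm_su2Quat_relGauge_sub_one_le {H : ℕ} {U : LGConfig 4 SU2} {g₀ g : Site 4 → SU2} (hg₀ : IsInteriorGauge H g₀)
    (hg : IsInteriorGauge H g) {r₀ r₁ : ℝ} (hr₀ : 0 ≤ r₀) (hr₁ : 0 ≤ r₁)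
    (hd₀ : ∀ e ∈ boxEdges 4 (2 * H + 1), linkDefect (gaugeTransformZd g₀ U) e ≤ r₀ ^ 2)
    (hd : ∀ e ∈ boxEdges 4 (2 * H + 1), linkDefect (gaugeTransformZd g U) e ≤ r₁ ^ 2) (x : Site 4) :
    ‖su2Quat (g x * (g₀ x)⁻¹) - 1‖ ≤ 2 * (r₀ + r₁) * H := by
  set V : LGConfig 4 SU2 := gaugeTransformZd g₀ U with hV
  set W : LGConfig 4 SU2 := gaugeTransformZd g U with hW
  set h : Site 4 → SU2 := fun y => g y * (g₀ y)⁻¹ with hh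
  have hh1 : ∀ y, y ∉ interiorSites H → h y = 1 := fun y hy => by simp [hh, hg y hy, hg₀ y hy]
  have hWh : ∀ e : ZdEdge 4, W e = h e.1 * V e * (h (e.1 + Pi.single e.2 1))⁻¹ := by
    intro e
    simp only [hW, hV, hh, gaugeTransformZd]
    group
  -- `su2Quat 1 = 1` (the tree's `FemtoTransferGap.su2Quat_one`, inlined to keep the import closure small)
  have hone : su2Quat (1 : SU2) = 1 := by
    apply Literature.MathematicalPhysics.QuantumFieldTheory.quatMatrix_injective
    rw [Literature.MathematicalPhysics.QuantumLattice.quatMatrix_su2Quat, Literature.MathematicalPhysics.QuantumLattice.quatMatrix_one]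
    rfl
  set ψ : Site 4 → ℍ := fun y => su2Quat (h y) with hψ
  have hψ1 : ∀ y, y ∉ interiorSites H → ψ y = 1 := fun y hy => by simp only [hψ, hh1 y hy, hone]
  have hnorm : ∀ y, ‖ψ y‖ = 1 := fun y => norm_su2Quat _
  have hqW : ∀ e : ZdEdge 4, su2Quat (W e) = ψ e.1 * su2Quat (V e) * star (ψ (e.1 + Pi.single e.2 1)) := by
    intro e; rw [hWh e, su2Quat_mul_mul_inv]
  have hVr : ∀ e ∈ boxEdges 4 (2 * H + 1), ‖su2Quat (V e) - 1‖ ≤ r₀ := fun e he => norm_su2Quat_sub_one_le hr₀ (hd₀ e he)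
  have hWr : ∀ e ∈ boxEdges 4 (2 * H + 1), ‖su2Quat (W e) - 1‖ ≤ r₁ := fun e he => norm_su2Quat_sub_one_le hr₁ (hd e he)
  have hedge : ∀ e ∈ boxEdges 4 (2 * H + 1), ‖ψ e.1 - ψ (e.1 + Pi.single e.2 1)‖ ≤ 2 * ((r₀ + r₁) / 2) := by
    intro e he
    have h1 := norm_sub_le_of_transform (su2Quat (V e)) (hnorm e.1) (hnorm (e.1 + Pi.single e.2 1))
    rw [← hqW e] at h1
    linarith [hVr e he, hWr e he]
  have hsup := norm_sub_one_le_of_edges (H := H) (by positivity : 0 ≤ (r₀ + r₁) / 2) ψ hψ1 hedge x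
  simp only [hψ, hh] at hsup
  linarith

/-- **Cutoff form**: on the support of `χ_r(U^g)` (every box link of `U^g` in the `2|r|`-ball) the relative transformation `g·g₀⁻¹`
is `2(r₀ + 2|r|)H`-close to the identity everywhere. -/
theorem norm_su2Quat_relGauge_sub_one_le_of_ballCutoff_ne_zero {H : ℕ} {U : LGConfig 4 SU2} {g₀ g : Site 4 → SU2}
    (hg₀ : IsInteriorGauge H g₀) (hg : IsInteriorGauge H g) {r₀ r : ℝ} (hr₀ : 0 ≤ r₀)
    (hd₀ : ∀ e ∈ boxEdges 4 (2 * H + 1), linkDefect (gaugeTransformZd g₀ U) e ≤ r₀ ^ 2)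
    (hχ : ballCutoff H r (gaugeTransformZd g U) ≠ 0) (x : Site 4) :
    ‖su2Quat (g x * (g₀ x)⁻¹) - 1‖ ≤ 2 * (r₀ + 2 * |r|) * H := by
  refine norm_su2Quat_relGauge_sub_one_le hg₀ hg hr₀ (by positivity) hd₀ (fun e he => ?_) x
  have h1 := linkDefect_lt_of_ballCutoff_ne_zero hχ he
  have h2 : (2 * |r|) ^ 2 = 4 * r ^ 2 := by rw [mul_pow, sq_abs]; norm_num
  rw [h2]; exact h1.le

/-- The same on the support of the weight `h_β = exp(−βΦ)·χ_r`. -/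
theorem norm_su2Quat_relGauge_sub_one_le_of_fpWeight_ne_zero {β : ℝ} {H : ℕ} {U : LGConfig 4 SU2} {g₀ g : Site 4 → SU2}
    (hg₀ : IsInteriorGauge H g₀) (hg : IsInteriorGauge H g) {r₀ r : ℝ} (hr₀ : 0 ≤ r₀)
    (hd₀ : ∀ e ∈ boxEdges 4 (2 * H + 1), linkDefect (gaugeTransformZd g₀ U) e ≤ r₀ ^ 2)
    (hw : fpWeight β H r (gaugeTransformZd g U) ≠ 0) (x : Site 4) :
    ‖su2Quat (g x * (g₀ x)⁻¹) - 1‖ ≤ 2 * (r₀ + 2 * |r|) * H :=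
  norm_su2Quat_relGauge_sub_one_le_of_ballCutoff_ne_zero hg₀ hg hr₀ hd₀ (right_ne_zero_of_mul hw) x

/-! ## (⊃) The cutoff is identically `1` near `g₀` -/

/-- For unit quaternions: `‖x q y⋆ − 1‖ ≤ ‖q − 1‖ + ‖x − y‖`. -/
theorem norm_conj_sub_one_le {x y : ℍ} (q : ℍ) (hx : ‖x‖ = 1) (hy : ‖y‖ = 1) :
    ‖x * q * star y - 1‖ ≤ ‖q - 1‖ + ‖x - y‖ := by
  have hyy : y * star y = 1 := by
    rw [Quaternion.self_mul_star, normSq_eq_norm_mul_self, hy, mul_one, Quaternion.coe_one]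
  have key : x * q * star y - 1 = x * (q - 1) * star y + (x - y) * star y := by
    rw [mul_sub, mul_one, sub_mul, sub_mul, hyy]
    abel
  have hsy : ‖star y‖ = 1 := by rw [Quaternion.norm_star, hy]
  calc ‖x * q * star y - 1‖ = ‖x * (q - 1) * star y + (x - y) * star y‖ := by rw [key]
    _ ≤ ‖x * (q - 1) * star y‖ + ‖(x - y) * star y‖ := norm_add_le _ _
    _ = ‖q - 1‖ + ‖x - y‖ := by rw [norm_mul, norm_mul, norm_mul, hx, hsy, one_mul, mul_one, mul_one]

/-- **A near-identity transformation keeps the ball**: if every box link of `V` has defect `≤ r₀²` and `‖su2Quat (h x) − 1‖ ≤ δ` for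
all `x`, then every box link of `V^h` has defect `≤ (r₀ + 2δ)²`. -/
theorem linkDefect_gaugeTransformZd_le_of_near_one {H : ℕ} {V : LGConfig 4 SU2} {h : Site 4 → SU2} {r₀ δ : ℝ} (hr₀ : 0 ≤ r₀)
    (hV : ∀ e ∈ boxEdges 4 (2 * H + 1), linkDefect V e ≤ r₀ ^ 2) (hh : ∀ x, ‖su2Quat (h x) - 1‖ ≤ δ)
    {e : ZdEdge 4} (he : e ∈ boxEdges 4 (2 * H + 1)) : linkDefect (gaugeTransformZd h V) e ≤ (r₀ + 2 * δ) ^ 2 := by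
  rw [linkDefect_eq_norm_sq]
  have hq : su2Quat (gaugeTransformZd h V e) = su2Quat (h e.1) * su2Quat (V e) * star (su2Quat (h (e.1 + Pi.single e.2 1))) := by
    show su2Quat (h e.1 * V e * (h (e.1 + Pi.single e.2 1))⁻¹) = _
    rw [su2Quat_mul_mul_inv]
  have h1 := norm_conj_sub_one_le (su2Quat (V e)) (norm_su2Quat (h e.1)) (norm_su2Quat (h (e.1 + Pi.single e.2 1)))
  have h2 : ‖su2Quat (h e.1) - su2Quat (h (e.1 + Pi.single e.2 1))‖ ≤ δ + δ := by
    calc ‖su2Quat (h e.1) - su2Quat (h (e.1 + Pi.single e.2 1))‖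
        = ‖(su2Quat (h e.1) - 1) - (su2Quat (h (e.1 + Pi.single e.2 1)) - 1)‖ := by rw [sub_sub_sub_cancel_right]
      _ ≤ ‖su2Quat (h e.1) - 1‖ + ‖su2Quat (h (e.1 + Pi.single e.2 1)) - 1‖ := norm_sub_le _ _
      _ ≤ δ + δ := add_le_add (hh _) (hh _)
  have h3 : ‖su2Quat (gaugeTransformZd h V e) - 1‖ ≤ r₀ + 2 * δ := by
    rw [hq]; linarith [norm_su2Quat_sub_one_le hr₀ (hV e he)]
  have h0 : 0 ≤ ‖su2Quat (gaugeTransformZd h V e) - 1‖ := norm_nonneg _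
  exact pow_le_pow_left₀ h0 h3 2

/-- **The cutoff is `1` near `g₀`**: with `V = U^{g₀}` in the `r₀`-ball and `h` `δ`-close to the identity, `χ_r((U^{g₀})^h) = 1` whenever
`r₀ + 2δ ≤ r`. -/
theorem ballCutoff_gaugeTransformZd_eq_one_of_near_one {H : ℕ} {V : LGConfig 4 SU2} {h : Site 4 → SU2} {r₀ δ r : ℝ} (hr₀ : 0 ≤ r₀)
    (hδ : 0 ≤ δ) (hr : 0 < r) (hV : ∀ e ∈ boxEdges 4 (2 * H + 1), linkDefect V e ≤ r₀ ^ 2) (hh : ∀ x, ‖su2Quat (h x) - 1‖ ≤ δ)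
    (hle : r₀ + 2 * δ ≤ r) : ballCutoff H r (gaugeTransformZd h V) = 1 := by
  refine ballCutoff_eq_one hr.ne' fun e he => (linkDefect_gaugeTransformZd_le_of_near_one hr₀ hV hh he).trans ?_
  exact pow_le_pow_left₀ (by positivity) hle 2

/-! ## The same through `extendGauge` (interior gauge transformations as `InteriorGauge H`) -/

/-- `extendGauge` commutes with inversion. -/
theorem extendGauge_inv {H : ℕ} (k : InteriorGauge H) : extendGauge H k⁻¹ = (extendGauge H k)⁻¹ := by
  funext x
  by_cases hx : x ∈ interiorSites H
  · simp only [Pi.inv_apply, extendGauge_of_mem _ hx]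
  · simp only [Pi.inv_apply, extendGauge_of_not_mem _ hx, inv_one]

/-- The relative transformation of two extended interior transformations is the extension of `k·k₀⁻¹`. -/
theorem extendGauge_relGauge {H : ℕ} (k k₀ : InteriorGauge H) :
    (fun x => extendGauge H k x * (extendGauge H k₀ x)⁻¹) = extendGauge H (k * k₀⁻¹) := by
  rw [extendGauge_mul, extendGauge_inv]; rfl

/-- At an interior site the relative extended transformation is `k x · (k₀ x)⁻¹`. -/
theorem extendGauge_relGauge_apply {H : ℕ} (k k₀ : InteriorGauge H) (x : ↥(interiorSites H)) :
    extendGauge H k x * (extendGauge H k₀ x)⁻¹ = k x * (k₀ x)⁻¹ := by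
  rw [extendGauge_of_mem k x.2, extendGauge_of_mem k₀ x.2]

/-- **T-S5.3 (⊂) for the orbit integral**: if `U^{ext k₀}` lies in the `r₀`-ball and `χ_r(U^{ext k}) ≠ 0`, then `k x·(k₀ x)⁻¹` is
`2(r₀ + 2|r|)H`-close to `1` at every interior site. -/
theorem orbitLocalisation_of_ballCutoff_ne_zero {H : ℕ} {U : LGConfig 4 SU2} (k₀ k : InteriorGauge H) {r₀ r : ℝ} (hr₀ : 0 ≤ r₀)
    (hd₀ : ∀ e ∈ boxEdges 4 (2 * H + 1), linkDefect (gaugeTransformZd (extendGauge H k₀) U) e ≤ r₀ ^ 2)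
    (hχ : ballCutoff H r (gaugeTransformZd (extendGauge H k) U) ≠ 0) (x : ↥(interiorSites H)) :
    ‖su2Quat (k x * (k₀ x)⁻¹) - 1‖ ≤ 2 * (r₀ + 2 * |r|) * H := by
  rw [← extendGauge_relGauge_apply]
  exact norm_su2Quat_relGauge_sub_one_le_of_ballCutoff_ne_zero (isInteriorGauge_extendGauge k₀) (isInteriorGauge_extendGauge k)
    hr₀ hd₀ hχ x

/-- The same on the support of the weight `h_β`. -/
theorem orbitLocalisation_of_fpWeight_ne_zero {β : ℝ} {H : ℕ} {U : LGConfig 4 SU2} (k₀ k : InteriorGauge H) {r₀ r : ℝ}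
    (hr₀ : 0 ≤ r₀) (hd₀ : ∀ e ∈ boxEdges 4 (2 * H + 1), linkDefect (gaugeTransformZd (extendGauge H k₀) U) e ≤ r₀ ^ 2)
    (hw : fpWeight β H r (gaugeTransformZd (extendGauge H k) U) ≠ 0) (x : ↥(interiorSites H)) :
    ‖su2Quat (k x * (k₀ x)⁻¹) - 1‖ ≤ 2 * (r₀ + 2 * |r|) * H :=
  orbitLocalisation_of_ballCutoff_ne_zero k₀ k hr₀ hd₀ (right_ne_zero_of_mul hw) x

/-- **T-S5.3 (⊃) for the orbit integral**: if `U^{ext k₀}` lies in the `r₀`-ball and `k x·(k₀ x)⁻¹` is `δ`-close to `1` at every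
interior site, then `χ_r(U^{ext k}) = 1` whenever `r₀ + 2δ ≤ r`. -/
theorem ballCutoff_orbit_eq_one {H : ℕ} {U : LGConfig 4 SU2} (k₀ k : InteriorGauge H) {r₀ δ r : ℝ} (hr₀ : 0 ≤ r₀) (hδ : 0 ≤ δ)
    (hr : 0 < r) (hd₀ : ∀ e ∈ boxEdges 4 (2 * H + 1), linkDefect (gaugeTransformZd (extendGauge H k₀) U) e ≤ r₀ ^ 2)
    (hk : ∀ x : ↥(interiorSites H), ‖su2Quat (k x * (k₀ x)⁻¹) - 1‖ ≤ δ) (hle : r₀ + 2 * δ ≤ r) :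
    ballCutoff H r (gaugeTransformZd (extendGauge H k) U) = 1 := by
  rw [← gaugeTransformZd_relGauge (extendGauge H k) (extendGauge H k₀) U]
  refine ballCutoff_gaugeTransformZd_eq_one_of_near_one hr₀ hδ hr hd₀ (fun x => ?_) hle
  by_cases hx : x ∈ interiorSites H
  · have := hk ⟨x, hx⟩
    rwa [← extendGauge_relGauge_apply] at this
  · have hone : su2Quat (1 : SU2) = 1 := by
      apply Literature.MathematicalPhysics.QuantumFieldTheory.quatMatrix_injective
      rw [Literature.MathematicalPhysics.QuantumLattice.quatMatrix_su2Quat, Literature.MathematicalPhysics.QuantumLattice.quatMatrix_one]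
      rfl
    rw [extendGauge_of_not_mem k hx, extendGauge_of_not_mem k₀ hx, inv_one, mul_one, hone, sub_self, norm_zero]
    exact hδ

end Summit.QuantumFields.YangMills.Theorems.AllWindowsColdBoxBoxHighLine

end
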